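import Summits.QuantumFields.YangMills.Theorems.SwapVirialDeficitSectorLaplaceBulkFibred
import HarnessLib

/-!
# (S)-road, stub S2 in the skeleton's letters — THE BULK FIBRED LAPLACE ESTIMATE ON THE BOX `|x₀|, |y₀| ≤ V₀` OVER THE BULK HUBS, with POLYNOMIAL constants
# (free-hands support of ⟨stmt-QuantumFields-24197⟩ `SwapVirialDeficit.SwapGluedStiffness` ∕ ⟨24194⟩; fcl-p3 g47's `stub_bulk_fibred` with `fibDir := gnoFibreEmb`,
# `basePt p := gnoBase p.1 p.2`, `alpha L := (7 + 3|Fol L|)/2`, and `boxIntegral ∕ mbDensity ∕ HubBulk ∕ BaseBox ∕ GoodSign` unfolded)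

Specialisation of ✓`bulk_fibred_cylinder` (part 1): base set `S := {|p.1| ≤ V₀ ∧ |p.2| ≤ V₀}`, bulk hubs `ψ₀ ≤ sin²2ψ(a)`, `ψ₀ ≤ sin²ψ(a)`, ONE coercivity constant
`μ′ := ψ₀/(27648·L¹⁰·(2 + V₀²))` (below w3 g65's four growth constants on the whole box), tube radius `R := μ′/(8(m+8)·414000L⁴)`; then every constant of part 1 is
dominated through the single quantity `U := 82944·L¹⁰·(V₀/ψ₀)²` (`1/μ′ ≤ U`, `m + 8 ≤ U`, `414000L⁴ ≤ 5U`): relative error `≤ 26963·U⁸/√b ≤ K₀·L⁸⁰·(V₀/ψ₀)⁸⁰·b^{−1/2}`,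
off-tube exponent `μ′R² ≥ 1/(1600U⁷) ≥ (ψ₀/(K₀L⁸⁰V₀⁸⁰))⁸⁰`, `K₀ := 26963·82944⁸`.

* §1 arithmetic letters (`finrank_gnoFibre_eq_card`, `baseBox_eq_Icc_prod`, `integrableOn_gnoDensity_gnoBase_box`, …);
* §2 ★★★ `bulk_fibred_box` — `∃ K > 0, ∃ k, ∀ L ψ₀ V₀ b …` EXACTLY the shape of g47's `stub_bulk_fibred` (skeleton HOME `fcl-p3-g47-SectorLaplaceSkeleton.lean` §2), with
  `K := 26963·82944⁸`, `k := 80`.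

HONEST LABEL: arithmetic on part 1; ⟨24197⟩ ∕ ⟨24194⟩ (window-uniform) OPEN; own crux ⟨22884⟩ OPEN (blocked-on ⟨19935⟩); no crux, rung of record or summit is proved; the
Yang–Mills mass gap is NOT proved; no summit is proved by a line.  Width seat ym-line-sfw-p2-w2 g59 (cell ym-idea-1, free hands), `--supports stmt-QuantumFields-24197`.
THEOREMS ONLY (0 `def`, 0 `sorry`), standard axioms.  References: [cite: Luscher1983, §2]; [cite: HasenpflugRudolfSprungk2024, App. 4.1 Thm 16]; [folklore].
-/

set_option autoImplicit false
set_option synthInstance.maxSize 1024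

noncomputable section

open MeasureTheory Quaternion Set Metric Module
open scoped BigOperators Quaternion ContDiff InnerProductSpace ENNReal
open Literature.MathematicalPhysics.QuantumFieldTheory hiding SU2
open Literature.MathematicalPhysics.QuantumLattice

namespace Summit.QuantumFields.YangMills.Theorems.SwapVirialDeficit.BlowUpRing

open Summit.QuantumFields.YangMills.Theorems.FemtoTransferGap
open Summit.QuantumFields.YangMills.Theorems.FemtoTransferGap.TT
open Summit.QuantumFields.YangMills.Theorems.VirialFluxGap.RingDeficit
open Summit.QuantumFields.YangMills.Theorems.SwapVirialDeficit.SwapRing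

variable {L : ℕ} [NeZero L]

/-! ## §1 Arithmetic letters -/

/-- `dim V_L = 7 + 3|Fol L|` as a real number (so `dim V_L / 2 = alpha L` of the skeleton). [folklore] -/
theorem finrank_gnoFibre_eq_card : (finrank ℝ (GnoFibre L) : ℝ) = 7 + 3 * (Fintype.card (Fol L) : ℝ) := by
  rw [finrank_euclideanSpace, card_gnoFibreIdx]; push_cast; ring

/-- `m + 8 = dim V_L + 8 ≤ 24L⁴`, and it is positive. [folklore] -/
theorem finrank_gnoFibre_add_eight_le : 0 < (finrank ℝ (GnoFibre L) : ℝ) + 8 ∧ (finrank ℝ (GnoFibre L) : ℝ) + 8 ≤ 24 * (L : ℝ) ^ 4 := by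
  rw [finrank_gnoFibre_real]
  have hL : (1 : ℝ) ≤ (L : ℝ) := by exact_mod_cast NeZero.one_le
  have hL4 : (1 : ℝ) ≤ (L : ℝ) ^ 4 := one_le_pow₀ hL
  constructor <;> nlinarith

/-- `|Fol L| ≤ 6L⁴` as reals (✓`card_fol`). [folklore] -/
theorem card_fol_real_le : (Fintype.card (Fol L) : ℝ) ≤ 6 * (L : ℝ) ^ 4 := by
  rw [card_fol]
  have h : (6 * L ^ 4 - 3 : ℕ) ≤ 6 * L ^ 4 := Nat.sub_le _ _
  exact_mod_cast h

/-- The box is a product of intervals. [folklore] -/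
theorem baseBox_eq_Icc_prod (V₀ : ℝ) : {p : ℝ × ℝ | |p.1| ≤ V₀ ∧ |p.2| ≤ V₀} = Set.Icc (-V₀) V₀ ×ˢ Set.Icc (-V₀) V₀ := by
  ext p
  simp only [mem_setOf_eq, mem_prod, mem_Icc, abs_le]

/-- The box is measurable. [folklore] -/
theorem measurableSet_baseBox (V₀ : ℝ) : MeasurableSet {p : ℝ × ℝ | |p.1| ≤ V₀ ∧ |p.2| ≤ V₀} := by
  rw [baseBox_eq_Icc_prod]; exact measurableSet_Icc.prod measurableSet_Icc

/-- The base density is integrable on the box (continuous on a compact set). [folklore] -/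
theorem integrableOn_gnoDensity_gnoBase_box (V₀ : ℝ) :
    IntegrableOn (fun p : ℝ × ℝ => gnoDensity (gnoBase p.1 p.2 : GnoCoord L)) {p : ℝ × ℝ | |p.1| ≤ V₀ ∧ |p.2| ≤ V₀} := by
  rw [baseBox_eq_Icc_prod]
  exact (gnoDensity_gnoBase_pos_continuous (L := L)).2.continuousOn.integrableOn_compact (isCompact_Icc.prod isCompact_Icc)

/-- On the box, `p.1² ≤ V₀²` and `p.2² ≤ V₀²`. [folklore] -/
theorem sq_le_of_mem_baseBox {V₀ : ℝ} {p : ℝ × ℝ} (hp : p ∈ {p : ℝ × ℝ | |p.1| ≤ V₀ ∧ |p.2| ≤ V₀}) : p.1 ^ 2 ≤ V₀ ^ 2 ∧ p.2 ^ 2 ≤ V₀ ^ 2 := by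
  obtain ⟨h1, h2⟩ := hp
  have hV : 0 ≤ V₀ := (abs_nonneg _).trans h1
  exact ⟨by rw [← sq_abs]; exact pow_le_pow_left₀ (abs_nonneg _) h1 2, by rw [← sq_abs]; exact pow_le_pow_left₀ (abs_nonneg _) h2 2⟩

/-- The coercivity constant `μ′ = ψ₀/(27648L¹⁰(2+V₀²))` is admissible on the whole box over the bulk hubs: the four inequalities of ✓`fibre_raySecond_coercive_gnomonic`.
[folklore] -/
theorem mu_admissible {a : ℍ} {ψ₀ V₀ : ℝ} (hψ₀ : 0 < ψ₀) (hψ₁ : ψ₀ ≤ 1) (hV₀ : 1 ≤ V₀)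
    (hS1 : ψ₀ ≤ (2 * (‖a‖⁻¹ * a.re) * (‖a‖⁻¹ * ‖a.im‖)) ^ 2) (hS2 : ψ₀ ≤ (‖a‖⁻¹ * ‖a.im‖) ^ 2)
    {p : ℝ × ℝ} (hp : p ∈ {p : ℝ × ℝ | |p.1| ≤ V₀ ∧ |p.2| ≤ V₀}) :
    ψ₀ / (27648 * (L : ℝ) ^ 10 * (2 + V₀ ^ 2)) ≤ 2 * (2 * (‖a‖⁻¹ * a.re) * (‖a‖⁻¹ * ‖a.im‖)) ^ 2 / ((2 + p.1 ^ 2) * (16200 * (L : ℝ) ^ 6)) ∧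
    ψ₀ / (27648 * (L : ℝ) ^ 10 * (2 + V₀ ^ 2)) ≤ 2 * (‖a‖⁻¹ * ‖a.im‖) ^ 2 / ((2 + p.2 ^ 2) * (16200 * (L : ℝ) ^ 6)) ∧
    ψ₀ / (27648 * (L : ℝ) ^ 10 * (2 + V₀ ^ 2)) ≤ 1 / (16200 * (L : ℝ) ^ 6) ∧
    ψ₀ / (27648 * (L : ℝ) ^ 10 * (2 + V₀ ^ 2)) ≤ (2304 * (L : ℝ) ^ 6 * (Fintype.card (Fol L) : ℝ))⁻¹ / 2 := by
  have hL : (1 : ℝ) ≤ (L : ℝ) := by exact_mod_cast NeZero.one_le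
  have hL6 : (1 : ℝ) ≤ (L : ℝ) ^ 6 := one_le_pow₀ hL
  have hL4 : (1 : ℝ) ≤ (L : ℝ) ^ 4 := one_le_pow₀ hL
  have hL10 : (L : ℝ) ^ 10 = (L : ℝ) ^ 6 * (L : ℝ) ^ 4 := by ring
  obtain ⟨hp1, hp2⟩ := sq_le_of_mem_baseBox hp
  have hden : 0 < 27648 * (L : ℝ) ^ 10 * (2 + V₀ ^ 2) := by positivity
  have hcard := card_fol_real_le (L := L)
  have hcard0 : (0 : ℝ) < Fintype.card (Fol L) := by
    have : 0 < Fintype.card (Fol L) := by rw [card_fol]; have := Nat.one_le_pow 4 L NeZero.one_le; omega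
    exact_mod_cast this
  refine ⟨?_, ?_, ?_, ?_⟩
  · rw [div_le_div_iff₀ hden (by positivity)]
    have h1 : ψ₀ * ((2 + p.1 ^ 2) * (16200 * (L : ℝ) ^ 6)) ≤ ψ₀ * ((2 + V₀ ^ 2) * (16200 * (L : ℝ) ^ 6)) := by gcongr
    have h2 : ψ₀ * ((2 + V₀ ^ 2) * (16200 * (L : ℝ) ^ 6)) ≤ 2 * ψ₀ * (27648 * (L : ℝ) ^ 10 * (2 + V₀ ^ 2)) := by
      rw [hL10]; nlinarith [mul_nonneg hψ₀.le (by positivity : (0 : ℝ) ≤ (2 + V₀ ^ 2) * (L : ℝ) ^ 6), mul_le_mul_of_nonneg_left hL4 (by positivity : (0 : ℝ) ≤ ψ₀ * ((2 + V₀ ^ 2) * (L : ℝ) ^ 6))]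
    have h3 : 2 * ψ₀ * (27648 * (L : ℝ) ^ 10 * (2 + V₀ ^ 2)) ≤ 2 * (2 * (‖a‖⁻¹ * a.re) * (‖a‖⁻¹ * ‖a.im‖)) ^ 2 * (27648 * (L : ℝ) ^ 10 * (2 + V₀ ^ 2)) := by gcongr
    linarith
  · rw [div_le_div_iff₀ hden (by positivity)]
    have h1 : ψ₀ * ((2 + p.2 ^ 2) * (16200 * (L : ℝ) ^ 6)) ≤ ψ₀ * ((2 + V₀ ^ 2) * (16200 * (L : ℝ) ^ 6)) := by gcongr
    have h2 : ψ₀ * ((2 + V₀ ^ 2) * (16200 * (L : ℝ) ^ 6)) ≤ 2 * ψ₀ * (27648 * (L : ℝ) ^ 10 * (2 + V₀ ^ 2)) := by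
      rw [hL10]; nlinarith [mul_nonneg hψ₀.le (by positivity : (0 : ℝ) ≤ (2 + V₀ ^ 2) * (L : ℝ) ^ 6), mul_le_mul_of_nonneg_left hL4 (by positivity : (0 : ℝ) ≤ ψ₀ * ((2 + V₀ ^ 2) * (L : ℝ) ^ 6))]
    have h3 : 2 * ψ₀ * (27648 * (L : ℝ) ^ 10 * (2 + V₀ ^ 2)) ≤ 2 * (‖a‖⁻¹ * ‖a.im‖) ^ 2 * (27648 * (L : ℝ) ^ 10 * (2 + V₀ ^ 2)) := by gcongr
    linarith
  · rw [div_le_div_iff₀ hden (by positivity)]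
    have h2 : ψ₀ * (16200 * (L : ℝ) ^ 6) ≤ 1 * (16200 * (L : ℝ) ^ 6) := by gcongr
    have h3 : (16200 : ℝ) * (L : ℝ) ^ 6 ≤ 27648 * (L : ℝ) ^ 10 * (2 + V₀ ^ 2) := by
      rw [hL10]; nlinarith [mul_le_mul_of_nonneg_left hL4 (by positivity : (0 : ℝ) ≤ (L : ℝ) ^ 6), sq_nonneg V₀, (by positivity : (0 : ℝ) ≤ (L : ℝ) ^ 6 * (L : ℝ) ^ 4 * V₀ ^ 2)]
    linarith
  · have e : (2304 * (L : ℝ) ^ 6 * (Fintype.card (Fol L) : ℝ))⁻¹ / 2 = 1 / (4608 * (L : ℝ) ^ 6 * (Fintype.card (Fol L) : ℝ)) := by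
      field_simp; ring
    rw [e, div_le_div_iff₀ hden (by positivity)]
    have h2 : ψ₀ * (4608 * (L : ℝ) ^ 6 * (Fintype.card (Fol L) : ℝ)) ≤ 1 * (4608 * (L : ℝ) ^ 6 * (6 * (L : ℝ) ^ 4)) := by
      have : 4608 * (L : ℝ) ^ 6 * (Fintype.card (Fol L) : ℝ) ≤ 4608 * (L : ℝ) ^ 6 * (6 * (L : ℝ) ^ 4) := by gcongr
      nlinarith [mul_nonneg hψ₀.le (by positivity : (0 : ℝ) ≤ 4608 * (L : ℝ) ^ 6 * (Fintype.card (Fol L) : ℝ))]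
    have h3 : 1 * (4608 * (L : ℝ) ^ 6 * (6 * (L : ℝ) ^ 4)) ≤ 1 * (27648 * (L : ℝ) ^ 10 * (2 + V₀ ^ 2)) := by
      rw [hL10]; nlinarith [sq_nonneg V₀, (by positivity : (0 : ℝ) ≤ (L : ℝ) ^ 6 * (L : ℝ) ^ 4), (by positivity : (0 : ℝ) ≤ (L : ℝ) ^ 6 * (L : ℝ) ^ 4 * V₀ ^ 2)]
    linarith

/-- The single dominating quantity: with `U := 82944·L¹⁰·(V₀/ψ₀)²`, `1/μ′ ≤ U`, `m + 8 ≤ U`, `414000L⁴ ≤ 5U`, `1 ≤ U`. [folklore] -/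
theorem dominator_bounds {ψ₀ V₀ : ℝ} (hψ₀ : 0 < ψ₀) (hψ₁ : ψ₀ ≤ 1) (hV₀ : 1 ≤ V₀) :
    (ψ₀ / (27648 * (L : ℝ) ^ 10 * (2 + V₀ ^ 2)))⁻¹ ≤ 82944 * (L : ℝ) ^ 10 * (V₀ / ψ₀) ^ 2 ∧
    (finrank ℝ (GnoFibre L) : ℝ) + 8 ≤ 82944 * (L : ℝ) ^ 10 * (V₀ / ψ₀) ^ 2 ∧
    414000 * (L : ℝ) ^ 4 ≤ 5 * (82944 * (L : ℝ) ^ 10 * (V₀ / ψ₀) ^ 2) ∧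
    1 ≤ 82944 * (L : ℝ) ^ 10 * (V₀ / ψ₀) ^ 2 := by
  have hL : (1 : ℝ) ≤ (L : ℝ) := by exact_mod_cast NeZero.one_le
  have hL4 : (1 : ℝ) ≤ (L : ℝ) ^ 4 := one_le_pow₀ hL
  have hL6 : (1 : ℝ) ≤ (L : ℝ) ^ 6 := one_le_pow₀ hL
  have hL10 : (L : ℝ) ^ 10 = (L : ℝ) ^ 6 * (L : ℝ) ^ 4 := by ring
  have ht : 1 ≤ V₀ / ψ₀ := by rw [le_div_iff₀ hψ₀]; linarith
  have ht2 : 1 ≤ (V₀ / ψ₀) ^ 2 := one_le_pow₀ ht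
  have hL10' : (1 : ℝ) ≤ (L : ℝ) ^ 10 := one_le_pow₀ hL
  -- `(2 + V₀²)/ψ₀ ≤ 3 (V₀/ψ₀)²`
  have hkey : (2 + V₀ ^ 2) / ψ₀ ≤ 3 * (V₀ / ψ₀) ^ 2 := by
    rw [div_pow, ← mul_div_assoc, div_le_div_iff₀ hψ₀ (by positivity)]
    have h1 : 2 + V₀ ^ 2 ≤ 3 * V₀ ^ 2 := by nlinarith
    have h2 : ψ₀ ^ 2 ≤ ψ₀ := by nlinarith
    calc (2 + V₀ ^ 2) * ψ₀ ^ 2 ≤ (3 * V₀ ^ 2) * ψ₀ := mul_le_mul h1 h2 (sq_nonneg _) (by positivity)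
      _ = 3 * V₀ ^ 2 * ψ₀ := by ring
  refine ⟨?_, ?_, ?_, le_trans (by norm_num) (mul_le_mul (mul_le_mul (le_refl (82944 : ℝ)) hL10' zero_le_one (by norm_num)) ht2 zero_le_one (by positivity))⟩
  · rw [inv_div]
    calc 27648 * (L : ℝ) ^ 10 * (2 + V₀ ^ 2) / ψ₀ = 27648 * (L : ℝ) ^ 10 * ((2 + V₀ ^ 2) / ψ₀) := by ring
      _ ≤ 27648 * (L : ℝ) ^ 10 * (3 * (V₀ / ψ₀) ^ 2) := by gcongr
      _ = 82944 * (L : ℝ) ^ 10 * (V₀ / ψ₀) ^ 2 := by ring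
  · have h := (finrank_gnoFibre_add_eight_le (L := L)).2
    calc (finrank ℝ (GnoFibre L) : ℝ) + 8 ≤ 24 * (L : ℝ) ^ 4 := h
      _ ≤ 82944 * (L : ℝ) ^ 10 * 1 := by rw [hL10]; nlinarith [mul_le_mul_of_nonneg_left hL6 (by positivity : (0 : ℝ) ≤ (L : ℝ) ^ 4)]
      _ ≤ 82944 * (L : ℝ) ^ 10 * (V₀ / ψ₀) ^ 2 := by gcongr
  · calc 414000 * (L : ℝ) ^ 4 ≤ 5 * (82944 * (L : ℝ) ^ 10 * 1) := by rw [hL10]; nlinarith [mul_le_mul_of_nonneg_left hL6 (by positivity : (0 : ℝ) ≤ (L : ℝ) ^ 4)]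
      _ ≤ 5 * (82944 * (L : ℝ) ^ 10 * (V₀ / ψ₀) ^ 2) := by gcongr

/-! ## §2 The bulk estimate in the skeleton's letters -/

/-- ★★★ **STUB S2 OF THE (S)-SKELETON — THE BULK FIBRED LAPLACE ESTIMATE, uniform in the cut, with polynomial constants** (`K := 26963·82944⁸`, `k := 80`): for every
cut `ψ₀ ∈ (0,1]`, box `V₀ ≥ 1`, `b ≥ (K L^k (V₀/ψ₀)^k)²`, bulk hub `a ≠ 0` (`ψ₀ ≤ sin²2ψ`, `ψ₀ ≤ sin²ψ`) and good signs, the box integral is the Morse–Bott main term up to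
the relative error `K L^k (V₀/ψ₀)^k b^{−1/2}` and the off-tube term `(∫ρ)·e^{−b(ψ₀/(K L^k V₀^k))^k}` — g47's `stub_bulk_fibred` with `fibDir := gnoFibreEmb`, letters unfolded.
[cite: Luscher1983, §2] [cite: HasenpflugRudolfSprungk2024, App. 4.1 Thm 16] -/
theorem bulk_fibred_box :
    ∃ K : ℝ, 0 < K ∧ ∃ k : ℕ, ∀ (L : ℕ) [NeZero L] (ψ₀ V₀ b : ℝ), 0 < ψ₀ → ψ₀ ≤ 1 → 1 ≤ V₀ →
      (K * (L : ℝ) ^ k * (V₀ / ψ₀) ^ k) ^ 2 ≤ b → ∀ a : ℍ, a ≠ 0 →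
        ψ₀ ≤ (2 * (‖a‖⁻¹ * a.re) * (‖a‖⁻¹ * ‖a.im‖)) ^ 2 → ψ₀ ≤ (‖a‖⁻¹ * ‖a.im‖) ^ 2 →
        ∀ ε : GnoSign L, ε.2.1 = true → (ε.2.2 = fun _ => true) →
          |(∫ η : GnoCoord L, {η : GnoCoord L | |η.1.1 0| ≤ V₀ ∧ |η.1.2 0| ≤ V₀}.indicator
                (fun η => Real.exp (-(b * gnoDeficit (fun _ => false) (fun _ => 1) a ε η)) * gnoDensity η) η) -
              (2 * Real.pi / b) ^ ((7 + 3 * (Fintype.card (Fol L) : ℝ)) / 2) *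
                ∫ p in {p : ℝ × ℝ | |p.1| ≤ V₀ ∧ |p.2| ≤ V₀},
                  gnoDensity (gnoBase p.1 p.2 : GnoCoord L) * ((2 * Real.pi) ^ ((7 + 3 * (Fintype.card (Fol L) : ℝ)) / 2))⁻¹ *
                    ∫ y : GnoFibre L, Real.exp (-(iteratedDeriv 2 (fun s : ℝ => gnoDeficit (fun _ => false) (fun _ => 1) a ε (gnoBase p.1 p.2 + s • gnoFibreEmb y)) 0 / 2))| ≤
            K * (L : ℝ) ^ k * (V₀ / ψ₀) ^ k * b ^ (-(1 / 2 : ℝ)) *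
                ((2 * Real.pi / b) ^ ((7 + 3 * (Fintype.card (Fol L) : ℝ)) / 2) *
                  ∫ p in {p : ℝ × ℝ | |p.1| ≤ V₀ ∧ |p.2| ≤ V₀},
                    gnoDensity (gnoBase p.1 p.2 : GnoCoord L) * ((2 * Real.pi) ^ ((7 + 3 * (Fintype.card (Fol L) : ℝ)) / 2))⁻¹ *
                      ∫ y : GnoFibre L, Real.exp (-(iteratedDeriv 2 (fun s : ℝ => gnoDeficit (fun _ => false) (fun _ => 1) a ε (gnoBase p.1 p.2 + s • gnoFibreEmb y)) 0 / 2))) +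
              (∫ η : GnoCoord L, gnoDensity η) * Real.exp (-(b * (ψ₀ / (K * (L : ℝ) ^ k * V₀ ^ k)) ^ k)) := by
  refine ⟨26963 * 82944 ^ 8, by positivity, 80, ?_⟩
  intro L _ ψ₀ V₀ b hψ₀ hψ₁ hV₀ hb a ha hS1 hS2 ε hz hε
  -- opaque letters for the dimension (keeps `finrank`/`Fintype.card` out of the arithmetic)
  obtain ⟨mR, hmR⟩ : ∃ m : ℝ, (finrank ℝ (GnoFibre L) : ℝ) = m := ⟨_, rfl⟩
  have hcardR : (7 : ℝ) + 3 * (Fintype.card (Fol L) : ℝ) = mR := by rw [← hmR, finrank_gnoFibre_eq_card]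
  obtain ⟨hm8pos, hm8le⟩ : 0 < mR + 8 ∧ mR + 8 ≤ 24 * (L : ℝ) ^ 4 := by rw [← hmR]; exact finrank_gnoFibre_add_eight_le (L := L)
  have hm8ne : mR + 8 ≠ 0 := ne_of_gt hm8pos
  have hm8ge : 8 ≤ mR + 8 := by rw [← hmR]; have := Nat.cast_nonneg (α := ℝ) (finrank ℝ (GnoFibre L)); linarith
  -- the letters
  set ℓ : ℝ := (L : ℝ) with hℓ
  set t : ℝ := V₀ / ψ₀ with ht
  set U : ℝ := 82944 * ℓ ^ 10 * t ^ 2 with hU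
  set μ' : ℝ := ψ₀ / (27648 * ℓ ^ 10 * (2 + V₀ ^ 2)) with hμ'
  set A₃ : ℝ := 414000 * ℓ ^ 4 with hA₃
  set R : ℝ := μ' / (8 * (mR + 8) * A₃) with hRdef
  set K₀ : ℝ := 26963 * 82944 ^ 8 with hK₀
  have hL1 : (1 : ℝ) ≤ ℓ := by rw [hℓ]; exact_mod_cast NeZero.one_le
  have ht1 : 1 ≤ t := by rw [ht, le_div_iff₀ hψ₀, one_mul]; exact hψ₁.trans hV₀
  -- threshold consequences (then `hb` is no longer needed)
  have hK1 : (1 : ℝ) ≤ K₀ := by rw [hK₀]; norm_num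
  have hKℓt : 1 ≤ K₀ * ℓ ^ 80 * t ^ 80 := by
    calc (1 : ℝ) = 1 * 1 * 1 := by ring
      _ ≤ K₀ * ℓ ^ 80 * t ^ 80 := mul_le_mul (mul_le_mul hK1 (one_le_pow₀ hL1) zero_le_one (by positivity)) (one_le_pow₀ ht1) zero_le_one (by positivity)
  have hb1 : 1 ≤ b := le_trans (one_le_pow₀ hKℓt) hb
  clear hb
  have hb0 : 0 < b := lt_of_lt_of_le one_pos hb1
  have hsb : 1 ≤ Real.sqrt b := by rw [← Real.sqrt_one]; exact Real.sqrt_le_sqrt hb1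
  obtain ⟨hμinv, hm8U, hA₃U, hU1⟩ := dominator_bounds (L := L) hψ₀ hψ₁ hV₀
  rw [hmR] at hm8U
  have hU0 : 0 < U := lt_of_lt_of_le one_pos hU1
  have hμpos : 0 < μ' := by rw [hμ']; positivity
  have hA₃pos : 0 < A₃ := by rw [hA₃]; positivity
  have hA₃1 : 2 ≤ A₃ := by
    rw [hA₃]
    have : (1 : ℝ) ≤ ℓ ^ 4 := one_le_pow₀ hL1
    calc (2 : ℝ) ≤ 414000 * 1 := by norm_num
      _ ≤ 414000 * ℓ ^ 4 := by gcongr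
  have hμU : 1 / U ≤ μ' := by
    rw [one_div, ← inv_inv μ']
    exact (inv_le_inv₀ hU0 (inv_pos.2 hμpos)).2 hμinv
  have hμ1 : μ' ≤ 1 := by
    rw [hμ', div_le_one (by positivity)]
    have h1 : (1 : ℝ) ≤ 27648 * ℓ ^ 10 * (2 + V₀ ^ 2) := by
      have h2 : (1 : ℝ) ≤ ℓ ^ 10 := one_le_pow₀ hL1
      have h3 : (1 : ℝ) ≤ 2 + V₀ ^ 2 := by nlinarith [sq_nonneg V₀]
      calc (1 : ℝ) = 1 * 1 * 1 := by ring
        _ ≤ 27648 * ℓ ^ 10 * (2 + V₀ ^ 2) := mul_le_mul (mul_le_mul (by norm_num) h2 zero_le_one (by norm_num)) h3 zero_le_one (by positivity)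
    exact hψ₁.trans h1
  have hp₀ : ((0 : ℝ), (0 : ℝ)) ∈ {p : ℝ × ℝ | |p.1| ≤ V₀ ∧ |p.2| ≤ V₀} :=
    ⟨by simpa using zero_le_one.trans hV₀, by simpa using zero_le_one.trans hV₀⟩
  -- radius bookkeeping
  have h8 : 128 ≤ 8 * (mR + 8) * A₃ := by
    calc (128 : ℝ) = 8 * 8 * 2 := by norm_num
      _ ≤ 8 * (mR + 8) * A₃ := mul_le_mul (mul_le_mul_of_nonneg_left hm8ge (by norm_num)) hA₃1 zero_le_two (by positivity)
  have hRpos : 0 < R := by rw [hRdef]; positivity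
  have hRhalf : R ≤ 1 / 2 := by
    rw [hRdef, div_le_iff₀ (by positivity)]
    calc μ' ≤ 1 := hμ1
      _ ≤ 1 / 2 * (8 * (mR + 8) * A₃) := by linarith
  have hR1 : R ≤ 1 := hRhalf.trans (by norm_num)
  have hsmall : 414000 * (L : ℝ) ^ 4 * R ≤ μ' / (8 * (mR + 8)) := by
    rw [← hℓ, ← hA₃, hRdef]
    rw [show A₃ * (μ' / (8 * (mR + 8) * A₃)) = μ' / (8 * (mR + 8)) by field_simp]
  have hDR : 2 * R * R ≤ 1 := by
    calc 2 * R * R ≤ 2 * (1 / 2) * 1 := by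
          refine mul_le_mul (mul_le_mul_of_nonneg_left hRhalf (by norm_num)) hR1 hRpos.le (by norm_num)
      _ = 1 := by norm_num
  -- (i) the relative error is dominated by `K₀ ℓ^80 t^80 / √b`
  have hμinv' : μ'⁻¹ ≤ U := hμinv
  have hT1 : 16 * (414000 * (L : ℝ) ^ 4) * (mR + 8) / μ' ≤ 80 * U ^ 3 := by
    rw [← hℓ, ← hA₃, div_eq_mul_inv]
    calc 16 * A₃ * (mR + 8) * μ'⁻¹ ≤ 16 * (5 * U) * U * U := by gcongr
      _ = 80 * U ^ 3 := by ring
  have hT2 : 256 * (414000 * (L : ℝ) ^ 4) * (mR + 8) ^ 2 / μ' ^ 2 ≤ 1280 * U ^ 5 := by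
    rw [← hℓ, ← hA₃, div_eq_mul_inv, ← inv_pow]
    calc 256 * A₃ * (mR + 8) ^ 2 * μ'⁻¹ ^ 2 ≤ 256 * (5 * U) * U ^ 2 * U ^ 2 := by gcongr
      _ = 1280 * U ^ 5 := by ring
  have hT3 : 2 * R ≤ 2 := by
    calc 2 * R ≤ 2 * 1 := by gcongr
      _ = 2 := by ring
  have hT4 : 8 * (2 * R) * (mR + 8) / μ' ≤ 1 := by
    rw [hRdef]
    rw [show 8 * (2 * (μ' / (8 * (mR + 8) * A₃))) * (mR + 8) / μ' = 2 / A₃ by field_simp]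
    rw [div_le_one hA₃pos]
    exact hA₃1
  have hT5 : 16 * (mR + 8) / (μ' * R ^ 2) ≤ 25600 * U ^ 8 := by
    rw [hRdef]
    rw [show 16 * (mR + 8) / (μ' * (μ' / (8 * (mR + 8) * A₃)) ^ 2) = 1024 * (mR + 8) ^ 3 * A₃ ^ 2 * μ'⁻¹ ^ 3 by field_simp; ring]
    calc 1024 * (mR + 8) ^ 3 * A₃ ^ 2 * μ'⁻¹ ^ 3 ≤ 1024 * U ^ 3 * (5 * U) ^ 2 * U ^ 3 := by gcongr
      _ = 25600 * U ^ 8 := by ring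
  have hU3 : U ^ 3 ≤ U ^ 8 := pow_le_pow_right₀ hU1 (by norm_num)
  have hU5 : U ^ 5 ≤ U ^ 8 := pow_le_pow_right₀ hU1 (by norm_num)
  have hU8 : 1 ≤ U ^ 8 := one_le_pow₀ hU1
  have hK3 : (16 * (414000 * (L : ℝ) ^ 4) * (mR + 8) / μ' + 256 * (414000 * (L : ℝ) ^ 4) * (mR + 8) ^ 2 / μ' ^ 2 + 2 * R + 8 * (2 * R) * (mR + 8) / μ') ≤
      1363 * U ^ 8 := by linarith
  have hK3nn : 0 ≤ (16 * (414000 * (L : ℝ) ^ 4) * (mR + 8) / μ' + 256 * (414000 * (L : ℝ) ^ 4) * (mR + 8) ^ 2 / μ' ^ 2 + 2 * R + 8 * (2 * R) * (mR + 8) / μ') := by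
    rw [← hℓ]; positivity
  have hrel : (16 * (414000 * (L : ℝ) ^ 4) * (mR + 8) / μ' + 256 * (414000 * (L : ℝ) ^ 4) * (mR + 8) ^ 2 / μ' ^ 2 + 2 * R + 8 * (2 * R) * (mR + 8) / μ') / Real.sqrt b +
      16 * (mR + 8) / (μ' * R ^ 2) / b ≤ K₀ * ℓ ^ 80 * t ^ 80 * b ^ (-(1 / 2 : ℝ)) := by
    have hsq : b ^ (-(1 / 2 : ℝ)) = 1 / Real.sqrt b := by
      rw [Real.rpow_neg hb0.le, Real.sqrt_eq_rpow, inv_eq_one_div]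
    have hbinv : 1 / b ≤ 1 / Real.sqrt b := by
      refine one_div_le_one_div_of_le (by positivity) ?_
      calc Real.sqrt b = Real.sqrt b * 1 := (mul_one _).symm
        _ ≤ Real.sqrt b * Real.sqrt b := by gcongr
        _ = b := Real.mul_self_sqrt hb0.le
    have hU8le : U ^ 8 ≤ 82944 ^ 8 * ℓ ^ 80 * t ^ 80 := by
      rw [hU, mul_pow, mul_pow, ← pow_mul, ← pow_mul]
      have : t ^ (2 * 8) ≤ t ^ 80 := pow_le_pow_right₀ ht1 (by norm_num)
      have h80 : ℓ ^ (10 * 8) = ℓ ^ 80 := by norm_num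
      rw [h80]; gcongr
    have hT5nn : 0 ≤ 16 * (mR + 8) / (μ' * R ^ 2) := by positivity
    calc _ ≤ 1363 * U ^ 8 / Real.sqrt b + 25600 * U ^ 8 / b := by gcongr
      _ = 1363 * U ^ 8 * (1 / Real.sqrt b) + 25600 * U ^ 8 * (1 / b) := by ring
      _ ≤ 1363 * U ^ 8 * (1 / Real.sqrt b) + 25600 * U ^ 8 * (1 / Real.sqrt b) := by gcongr
      _ = 26963 * U ^ 8 * (1 / Real.sqrt b) := by ring
      _ ≤ 26963 * (82944 ^ 8 * ℓ ^ 80 * t ^ 80) * (1 / Real.sqrt b) := by gcongr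
      _ = K₀ * ℓ ^ 80 * t ^ 80 * b ^ (-(1 / 2 : ℝ)) := by rw [hsq, hK₀]; ring
  -- (ii) the off-tube exponent
  have hexp : Real.exp (-(b * (μ' * R ^ 2))) ≤ Real.exp (-(b * (ψ₀ / (K₀ * (L : ℝ) ^ 80 * V₀ ^ 80)) ^ 80)) := by
    rw [Real.exp_le_exp, neg_le_neg_iff, ← hℓ]
    refine mul_le_mul_of_nonneg_left ?_ hb0.le
    have hV1 : 1 ≤ V₀ := hV₀
    have hx0 : 0 ≤ ψ₀ / (K₀ * ℓ ^ 80 * V₀ ^ 80) := by positivity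
    have hx1 : ψ₀ / (K₀ * ℓ ^ 80 * V₀ ^ 80) ≤ 1 := by
      rw [div_le_one (by positivity)]
      calc ψ₀ ≤ 1 := hψ₁
        _ = 1 * 1 * 1 := by ring
        _ ≤ K₀ * ℓ ^ 80 * V₀ ^ 80 := mul_le_mul (mul_le_mul hK1 (one_le_pow₀ hL1) zero_le_one (by positivity)) (one_le_pow₀ hV1) zero_le_one (by positivity)
    have h14 : (ψ₀ / (K₀ * ℓ ^ 80 * V₀ ^ 80)) ^ 80 ≤ (ψ₀ / (K₀ * ℓ ^ 80 * V₀ ^ 80)) ^ 14 := pow_le_pow_of_le_one hx0 hx1 (by norm_num)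
    have hden : (1600 : ℝ) * 82944 ^ 7 * ℓ ^ 70 * V₀ ^ 14 ≤ K₀ ^ 14 * ℓ ^ (80 * 14) * V₀ ^ (80 * 14) := by
      have h1 : (1600 : ℝ) * 82944 ^ 7 ≤ K₀ ^ 14 := by
        calc (1600 : ℝ) * 82944 ^ 7 ≤ K₀ := by rw [hK₀]; norm_num
          _ = K₀ ^ 1 := (pow_one _).symm
          _ ≤ K₀ ^ 14 := pow_le_pow_right₀ hK1 (by norm_num)
      have h2 : ℓ ^ 70 ≤ ℓ ^ (80 * 14) := pow_le_pow_right₀ hL1 (by norm_num)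
      have h3 : V₀ ^ 14 ≤ V₀ ^ (80 * 14) := pow_le_pow_right₀ hV1 (by norm_num)
      exact mul_le_mul (mul_le_mul h1 h2 (by positivity) (by positivity)) h3 (by positivity) (by positivity)
    have hstep : (ψ₀ / (K₀ * ℓ ^ 80 * V₀ ^ 80)) ^ 14 ≤ ψ₀ ^ 14 / (1600 * 82944 ^ 7 * ℓ ^ 70 * V₀ ^ 14) := by
      rw [div_pow, mul_pow, mul_pow, ← pow_mul, ← pow_mul]
      exact div_le_div_of_nonneg_left (by positivity) (by positivity) hden
    have hUeq : ψ₀ ^ 14 / (1600 * 82944 ^ 7 * ℓ ^ 70 * V₀ ^ 14) = 1 / (1600 * U ^ 7) := by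
      rw [hU, ht]; field_simp
    have hlow : 1 / (1600 * U ^ 7) ≤ μ' * R ^ 2 := by
      rw [hRdef]
      rw [show μ' * (μ' / (8 * (mR + 8) * A₃)) ^ 2 = μ' ^ 3 / (64 * (mR + 8) ^ 2 * A₃ ^ 2) by field_simp; ring]
      rw [div_le_div_iff₀ (by positivity) (by positivity)]
      have hUμ : 1 ≤ μ' * U := (div_le_iff₀ hU0).1 hμU
      have hUμ3 : 1 ≤ (μ' * U) ^ 3 := one_le_pow₀ hUμ
      calc 1 * (64 * (mR + 8) ^ 2 * A₃ ^ 2) ≤ 1 * (64 * U ^ 2 * (5 * U) ^ 2) := by gcongr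
        _ = 1600 * U ^ 4 * 1 := by ring
        _ ≤ 1600 * U ^ 4 * (μ' * U) ^ 3 := by gcongr
        _ = μ' ^ 3 * (1600 * U ^ 7) := by ring
    calc (ψ₀ / (K₀ * ℓ ^ 80 * V₀ ^ 80)) ^ 80 ≤ (ψ₀ / (K₀ * ℓ ^ 80 * V₀ ^ 80)) ^ 14 := h14
      _ ≤ ψ₀ ^ 14 / (1600 * 82944 ^ 7 * ℓ ^ 70 * V₀ ^ 14) := hstep
      _ = 1 / (1600 * U ^ 7) := hUeq
      _ ≤ μ' * R ^ 2 := hlow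
  -- part 1 on the box (letters: `finrank ↦ mR`, and the goal's `7 + 3|Fol L| ↦ mR`)
  have hadm := fun (p : ℝ × ℝ) (hp : p ∈ {p : ℝ × ℝ | |p.1| ≤ V₀ ∧ |p.2| ≤ V₀}) => mu_admissible (L := L) hψ₀ hψ₁ hV₀ hS1 hS2 hp
  have hbox := bulk_fibred_cylinder (L := L) ha ε hz hε (measurableSet_baseBox V₀) hp₀ (integrableOn_gnoDensity_gnoBase_box V₀) hμpos
    (fun p hp => (hadm p hp).1) (fun p hp => (hadm p hp).2.1) (hadm _ hp₀).2.2.1 (hadm _ hp₀).2.2.2 hRpos hR1 (by rw [hmR]; exact hsmall) hDR hb0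
  rw [hmR] at hbox
  rw [hcardR]
  have hcyl : {η : GnoCoord L | (η.1.1 0, η.1.2 0) ∈ {p : ℝ × ℝ | |p.1| ≤ V₀ ∧ |p.2| ≤ V₀}} = {η : GnoCoord L | |η.1.1 0| ≤ V₀ ∧ |η.1.2 0| ≤ V₀} := rfl
  rw [hcyl] at hbox
  -- the main term is non-negative
  set Main : ℝ := (2 * Real.pi / b) ^ (mR / 2) *
      ∫ p in {p : ℝ × ℝ | |p.1| ≤ V₀ ∧ |p.2| ≤ V₀},
        gnoDensity (gnoBase p.1 p.2 : GnoCoord L) * ((2 * Real.pi) ^ (mR / 2))⁻¹ *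
          ∫ y : GnoFibre L, Real.exp (-(iteratedDeriv 2 (fun s : ℝ => gnoDeficit (fun _ => false) (fun _ => 1) a ε (gnoBase p.1 p.2 + s • gnoFibreEmb y)) 0 / 2)) with hMain
  have hMain0 : 0 ≤ Main := by
    rw [hMain]
    refine mul_nonneg (Real.rpow_nonneg (by positivity) _) (setIntegral_nonneg (measurableSet_baseBox V₀) fun p _ => ?_)
    exact mul_nonneg (mul_nonneg (gnoDensity_pos _).le (inv_nonneg.2 (Real.rpow_nonneg (by positivity) _))) (integral_nonneg fun y => (Real.exp_pos _).le)
  -- assemble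
  have hρ0 : 0 ≤ ∫ η : GnoCoord L, gnoDensity η := integral_nonneg fun η => (gnoDensity_pos η).le
  calc _ ≤ _ := hbox
    _ ≤ K₀ * ℓ ^ 80 * t ^ 80 * b ^ (-(1 / 2 : ℝ)) * Main + (∫ η : GnoCoord L, gnoDensity η) * Real.exp (-(b * (ψ₀ / (K₀ * (L : ℝ) ^ 80 * V₀ ^ 80)) ^ 80)) := by
        rw [mul_comm (Real.exp _)]
        exact add_le_add (mul_le_mul_of_nonneg_right hrel hMain0) (mul_le_mul_of_nonneg_left hexp hρ0)

end Summit.QuantumFields.YangMills.Theorems.SwapVirialDeficit.BlowUpRing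

end
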